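import Summits.ValiantsHypothesis.ValiantsHypothesis.Cruxes.OrbitDimensionBound.Lines.ChannelLadder

/-! # F4 — on-path lemma `S → Rung` for the channel rung (sorry-free). -/

open Summit.ValiantsHypothesis.ValiantsHypothesis.Cruxes.OrbitDimensionBound.Channel

/-- `ValiantsHypothesis → OneChannelShadow`. -/
theorem OneChannelShadow_of_ValiantsHypothesis : _root_.ValiantsHypothesis → OneChannelShadow :=
  oneChannelShadow_of_summit

/-- The funnel's tactic battery finds it (`aesop` via the `@[aesop safe apply]` tag). -/
example : _root_.ValiantsHypothesis → OneChannelShadow := by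
  intro h; aesop
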